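import Literature.IUT.LogThetaLattice.TimesMuSideOfStrips
import Mathlib.CategoryTheory.ObjectProperty.FullSubcategory

/-!
# `Isomorphs M₀` ≌ Mathlib's full subcategory on "isomorphic to `M₀`" (dedup bridge)

Mochizuki, *Inter-universal Teichmüller Theory II*, kurims manuscript (Dec 2020), Def 4.9 (vii)/(viii) p. 158 ("a collection of
data … that is isomorphic to `‡F^{⊢▶×μ}_v`"); *I* (May 2020), Def 4.1 (iii) p. 96, Def 5.2 (i)(ii) p. 134. ([IUTchII] Def 4.9 (vii) p.158)
[claim: Mochizuki2012, status: disputed]. DEDUP BRIDGE (plan/L6/MERGE-MAP.md §4 C9-class), seat abc-iut-L6-t3 (gen 4); definitions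
only, nothing asserted.

The tree carries TWO typings of print's clause "isomorphic to the model" as a sub-groupoid: this seat's hand-rolled
`Literature.IUT.LogThetaLattice.Isomorphs M₀` (`TimesMuSideOfStrips.lean`; plain morphisms, used by `TimesMuSide.ofPassages`,
`BiCoricData.ofKits`, …) and abc-iut-w5-d087's `Literature.IUT.HodgeArakelov.KitComponent M :=
(kitProperty M).FullSubcategory` with `kitProperty M := fun S => Nonempty (S ≅ M)` (`RealifiedPrimeStripSplitComponent.lean`, Mathlib's
`ObjectProperty.FullSubcategory`, wrapped morphisms). This file records, once and generically, that they are the SAME category: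
`Isomorphs.isoProperty M₀` (the object property), the mutually inverse functors `Isomorphs.toFullSubcategory` /
`Isomorphs.ofFullSubcategory` (identity on objects and on underlying morphisms), both fully faithful and essentially surjective
(`isEquivalence_toFullSubcategory` / `_ofFullSubcategory`; `Isomorphs.equivFullSubcategory M₀ : Isomorphs M₀ ≌ (Isomorphs.isoProperty M₀).FullSubcategory`), and
the surjectivity of both comparison functors on isomorphisms (`toFullSubcategory_mapIso_surjective`, `ofFullSubcategory_mapIso_surjective`), so that results stated
for either typing (e.g. abc-iut-w5-d087's `KitComponent.mapIso_toTimesMu_surjective`, this seat's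
`TimesMuSide.ofPassages_mapIso_surjective`) are interchangeable. `KitComponent M` is literally
`(Isomorphs.isoProperty M).FullSubcategory` (`rfl`, not restated here to keep the import light).
-/

namespace Literature.IUT.LogThetaLattice

open CategoryTheory

universe v₁ u₁

namespace Isomorphs

variable {C : Type u₁} [Category.{v₁} C] (M₀ : C)

/-- **IUTchII:Def4.9(vii)** (kurims p.158) The object property "is isomorphic to the model `M₀`" (abc-iut-w5-d087's `kitProperty M`,
generically). ([IUTchII] Def 4.9 (vii) p.158) [claim: Mochizuki2012, status: disputed] -/
def isoProperty : ObjectProperty C := fun A => Nonempty (A ≅ M₀)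

/-- **IUTchII:Def4.9(vii)** (kurims p.158) Membership in `isoProperty M₀` is "isomorphic to `M₀`" (definitional unfolding).
([IUTchII] Def 4.9 (vii) p.158) [claim: Mochizuki2012, status: disputed] -/
theorem isoProperty_iff (A : C) : isoProperty M₀ A ↔ Nonempty (A ≅ M₀) := Iff.rfl

/-- **IUTchII:Def4.9(vii)** (kurims p.158) `Isomorphs M₀ ⥤` the full subcategory on `isoProperty M₀`: identity on objects, wrap the morphism.
([IUTchII] Def 4.9 (vii) p.158) [claim: Mochizuki2012, status: disputed] -/
def toFullSubcategory : Isomorphs M₀ ⥤ (isoProperty M₀).FullSubcategory where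
  obj A := ⟨A.obj, A.isModel⟩
  map f := ObjectProperty.homMk f

/-- **IUTchII:Def4.9(vii)** (kurims p.158) The full subcategory on `isoProperty M₀ ⥤ Isomorphs M₀`: identity on objects, unwrap the morphism.
([IUTchII] Def 4.9 (vii) p.158) [claim: Mochizuki2012, status: disputed] -/
def ofFullSubcategory : (isoProperty M₀).FullSubcategory ⥤ Isomorphs M₀ where
  obj B := ⟨B.obj, B.property⟩
  map g := g.hom

/-- **IUTchII:Def4.9(vii)** (kurims p.158) `toFullSubcategory` on objects keeps the underlying object. ([IUTchII] Def 4.9 (vii) p.158)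
[claim: Mochizuki2012, status: disputed] -/
@[simp] theorem toFullSubcategory_obj_obj (A : Isomorphs M₀) : ((toFullSubcategory M₀).obj A).obj = A.obj := rfl

/-- **IUTchII:Def4.9(vii)** (kurims p.158) `toFullSubcategory` on morphisms wraps the underlying morphism. ([IUTchII] Def 4.9 (vii) p.158)
[claim: Mochizuki2012, status: disputed] -/
@[simp] theorem toFullSubcategory_map_hom {A B : Isomorphs M₀} (f : A ⟶ B) :
    ((toFullSubcategory M₀).map f).hom = f := rfl

/-- **IUTchII:Def4.9(vii)** (kurims p.158) `ofFullSubcategory` on objects keeps the underlying object. ([IUTchII] Def 4.9 (vii) p.158)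
[claim: Mochizuki2012, status: disputed] -/
@[simp] theorem ofFullSubcategory_obj_obj (B : (isoProperty M₀).FullSubcategory) :
    ((ofFullSubcategory M₀).obj B).obj = B.obj := rfl

/-- **IUTchII:Def4.9(vii)** (kurims p.158) `ofFullSubcategory` on morphisms is the underlying morphism. ([IUTchII] Def 4.9 (vii) p.158)
[claim: Mochizuki2012, status: disputed] -/
@[simp] theorem ofFullSubcategory_map {A B : (isoProperty M₀).FullSubcategory} (g : A ⟶ B) :
    (ofFullSubcategory M₀).map g = g.hom := rfl

/-- **IUTchII:Def4.9(vii)** (kurims p.158) `toFullSubcategory` is FULLY FAITHFUL (morphisms correspond exactly: wrap / unwrap).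
([IUTchII] Def 4.9 (vii) p.158) [claim: Mochizuki2012, status: disputed] -/
def fullyFaithfulToFullSubcategory : (toFullSubcategory M₀).FullyFaithful where
  preimage g := g.hom
  map_preimage _ := rfl
  preimage_map _ := rfl

/-- **IUTchII:Def4.9(vii)** (kurims p.158) `ofFullSubcategory` is FULLY FAITHFUL. ([IUTchII] Def 4.9 (vii) p.158) [claim: Mochizuki2012, status: disputed] -/
def fullyFaithfulOfFullSubcategory : (ofFullSubcategory M₀).FullyFaithful where
  preimage f := ObjectProperty.homMk f
  map_preimage _ := rfl
  preimage_map _ := rfl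

/-- **IUTchII:Def4.9(vii)** (kurims p.158) `toFullSubcategory` is ESSENTIALLY SURJECTIVE (indeed bijective on objects).
([IUTchII] Def 4.9 (vii) p.158) [claim: Mochizuki2012, status: disputed] -/
theorem essSurj_toFullSubcategory : (toFullSubcategory M₀).EssSurj :=
  ⟨fun B => ⟨⟨B.obj, B.property⟩, ⟨Iso.refl _⟩⟩⟩

/-- **IUTchII:Def4.9(vii)** (kurims p.158) `ofFullSubcategory` is ESSENTIALLY SURJECTIVE (indeed bijective on objects).
([IUTchII] Def 4.9 (vii) p.158) [claim: Mochizuki2012, status: disputed] -/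
theorem essSurj_ofFullSubcategory : (ofFullSubcategory M₀).EssSurj :=
  ⟨fun A => ⟨⟨A.obj, A.isModel⟩, ⟨Iso.refl _⟩⟩⟩

/-- **IUTchII:Def4.9(vii)** (kurims p.158) **The two typings of "objects isomorphic to the model" are the same category**: `toFullSubcategory`
is an EQUIVALENCE of categories `Isomorphs M₀ ⥤ (isoProperty M₀).FullSubcategory` — in particular onto abc-iut-w5-d087's
`KitComponent M = (isoProperty M).FullSubcategory` — so results stated for either typing are interchangeable.
([IUTchII] Def 4.9 (vii) p.158) [claim: Mochizuki2012, status: disputed] -/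
theorem isEquivalence_toFullSubcategory : (toFullSubcategory M₀).IsEquivalence where
  faithful := (fullyFaithfulToFullSubcategory M₀).faithful
  full := (fullyFaithfulToFullSubcategory M₀).full
  essSurj := essSurj_toFullSubcategory M₀

/-- **IUTchII:Def4.9(vii)** (kurims p.158) … and so is `ofFullSubcategory` in the other direction.
([IUTchII] Def 4.9 (vii) p.158) [claim: Mochizuki2012, status: disputed] -/
theorem isEquivalence_ofFullSubcategory : (ofFullSubcategory M₀).IsEquivalence where
  faithful := (fullyFaithfulOfFullSubcategory M₀).faithful
  full := (fullyFaithfulOfFullSubcategory M₀).full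
  essSurj := essSurj_ofFullSubcategory M₀

/-- **IUTchII:Def4.9(vii)** (kurims p.158) The equivalence of categories `Isomorphs M₀ ≌ (isoProperty M₀).FullSubcategory` determined by
`toFullSubcategory`. ([IUTchII] Def 4.9 (vii) p.158) [claim: Mochizuki2012, status: disputed] -/
noncomputable def equivFullSubcategory : Isomorphs M₀ ≌ (isoProperty M₀).FullSubcategory :=
  haveI := isEquivalence_toFullSubcategory M₀
  (toFullSubcategory M₀).asEquivalence

/-- **IUTchII:Cor4.10(iv)** (kurims p.160) TRANSFER of isomorphisms along the identification: every isomorphism of the full subcategory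
between images is the image of an isomorphism of `Isomorphs M₀` (so iso-surjectivity / "full poly-isomorphism ↦ full
poly-isomorphism" statements — abc-iut-w5-d087's `KitComponent.mapIso_toTimesMu_surjective`, this seat's
`TimesMuSide.ofPassages_mapIso_surjective` — transfer between the two typings). ([IUTchII] Cor 4.10 (iv) p.160)
[claim: Mochizuki2012, status: disputed] -/
theorem toFullSubcategory_mapIso_surjective (A B : Isomorphs M₀) :
    Function.Surjective ((toFullSubcategory M₀).mapIso : (A ≅ B) → _) := fun e =>
  ⟨isoMk ((isoProperty M₀).ι.mapIso e), by ext; rfl⟩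

/-- **IUTchII:Cor4.10(iv)** (kurims p.160) … and in the other direction. ([IUTchII] Cor 4.10 (iv) p.160) [claim: Mochizuki2012, status: disputed] -/
theorem ofFullSubcategory_mapIso_surjective (A B : (isoProperty M₀).FullSubcategory) :
    Function.Surjective ((ofFullSubcategory M₀).mapIso : (A ≅ B) → _) := fun e =>
  ⟨ObjectProperty.isoMk _ ((ι M₀).mapIso e), by ext; rfl⟩

end Isomorphs

end Literature.IUT.LogThetaLattice
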